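import Summits.QuantumFields.YangMills.Theorems.BalabanUVNodesN19TargetAtHomes13
import Summits.QuantumFields.YangMills.Theorems.BalabanUVNodesN27AtRecord13HomeOn
import Summits.QuantumFields.YangMills.Theorems.BalabanUVNodesN19SourceSplit

/-!
# BalabanUVNodes ∕ N19 (NE7 proper) — node U5's DECL TARGET AT THE REGIME-RESTRICTED, TUPLE-KEYED STAGE-13 CARRIER HOMES `YMDAG.UVSplit.SRec₁₃On cr Rg`
# (dag-n20-d `…SpineCarriersOfRecord13` §4, p490271) ∕ `YMDAG.UVSplit.RRec₁₃On 𝔯 Rg` (dag-n22-e 5″ `…RateCarriersOfRecord13On`), both read AT θ, any regime `Rg` — in particular at the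
# GUARD OF RECORD `Node00.unityNondeg₁₃ N` (rev 16's K3‴ prefix) — and THE SOURCE-SPLIT PRODUCER INTERFACE of the N19′ edge at the Stage-13 tuples; the ₁₃ twin of module 10
# (`…N19TargetAtHomes12On`, p473412), token for token with `12 ↦ 13`, plus §5

Cell `pub-ymgap` (HUMAN RULING D-0062, Track A), R134 ACCELERATION seat `pub-ymgap-dag-n19-d` (strategy s2 «by-name knit at the record»), gen 7, module 24.  Director-ym LINE №125 (3) «the ₁₂
modules re-instantiate at Stage 13»; LINE №138 «K1∕K2∕K3 lane work continues on the ₁₃ objects» (rev 18 changes ids, not objects); dag-ref-H XXVII-PRE-READ-NOTE shape (b) «guard INSIDE the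
stubs, read AT θ».  Filed `--kind proof --supports stmt-QuantumFields-19912 --as helper` (K3‴ `SpineGivenEndpointR13`).  COUNT-NEUTRAL.  NO Theses import (restate-immune; the route-facing
`N = 2` one-liners are n27-c XXXVII `spineGivenEndpointR13_of_homes₁₃On(_faces)` ∕ `_of_homes₁₃CN`, which CONSUME the `h19` binder this module's §4 PRODUCES from a source-split reading).
dag-n27-c `FIELD-TABLE-R13.md` row h19 «none at ₁₃ yet (₁₂: n19-d `s_N19_sRec₁₂On_inputsAll_of_towerEdge` …) — their ₁₃ re-key»: THIS MODULE (with 23 `…TargetAtRecord13`, 23b `…TargetAtHomes13`).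

WHAT IS KERNEL-CHECKED (BY NAME over n27-c XXXIX `…N27AtRecord13HomeOn` ∕ modules 6b · 23 · 23b ∕ n19-e `…N19SourceSplit`; every decl ONE application).
* §1 N19's faces at the regime spine home: `s_N19_sRec₁₃On_iff`, `s_N21_sRec₁₃On_iff` (the shell face U5 reads; (T-SPINE)₁₃ typed N20's), and UNDER THE INTERIM PIN `(cr …).δ = deltaOfRecord …`
  (`summable_deltaOfRecord` TRUE BY CONSTRUCTION — DISPLAYED, never progress): `s_U4_sRec₁₃On_iff_lt_one_of_pin`, `s_N19_sRec₁₃On_iff_coreEdge_of_pin`, the director's R134 row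
  `hybridNE7_at_sRec₁₃On_of_pin` (`HybridNE7` field by field at every bundle the regime home pins), and `s_N19_sRec₁₃On_inputsAll_of_towerEdge` (XXXIX's edge ⇒ N19's K5 stub at the two
  regime homes with K4's ∀-hook);
* (§2 of module 10 — per-run-length ⇒ all-run-lengths θ-form, `k = 0` — is not re-typed: one `fun … => h … 0 (hall 0)` at any call site;)
* §3 node U5's target at every admissible Stage-13 tuple IN THE REGIME: the literal :183 road `matching_guarded_datumOfRecord₁₃_of_coreEdge` (conclusion `∃ l₀ vol δ′, 0 < l₀ ∧ Summable δ′ ∧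
  MatchingModConstants vol l₀ δ′ (schemeZ …)` per loop string — the NODE-TABLE DECL target :99 through `HybridNE7.matchingModConstants` :183), and
  `matchingUnder_guarded_datumOfRecord₁₃_of_homes₁₃On(_faces)` (XXXIX `forall_guarded₁₃_of_homes₁₃On(_faces)` ∘ module 23 `hybridNE7Under_datumOfRecord₁₃_iff_matchingUnder`);
* §4 THE SOURCE-SPLIT PRODUCER INTERFACE (dag-n19-e's located FIRST MISSING ESTIMATE for N19: (V) class-uniform VACUUM matching + (I) per-class SOURCE-RESPONSE matching of the two runs,
  `N19SourceSplit.core_of_vacuum_of_insertion` ∕ `core_of_vacuum_of_insertionDeriv` BY NAME): `towerEdge₁₃On_of_sourceSplitReading` ∕ `towerEdge₁₃On_of_insertionDerivReading` PRODUCE XXXIX's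
  edge binder, hence `matchingUnder_guarded_datumOfRecord₁₃_of_homes₁₃On_sourceSplit`;
* §5 at the GUARD OF RECORD `Rg := Node00.unityNondeg₁₃ N` (`θ.ZtUnity F N ∧ θ.SlotsNondegenerate₁₃ F N`; (T-SPINE)₁₃'s `SRec₁₃U cr` is `SRec₁₃On cr (unityNondeg₁₃ N)` by `rfl`):
  `matchingUnder_unityNondeg_datumOfRecord₁₃_of_homes₁₃On` — at `N = 2` the body of K3‴ up to its two displayed antecedents, in node U5's currency.

HONEST FRAMING.  Bookkeeping over hypothesis SHAPES: every stub, reading, regime and edge is a HYPOTHESIS ∕ PARAMETER with no producer at any record today (0∕1); `cr`, `𝔯`, `Rg` PARAMETERS (no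
reading of Bałaban's dressed two-run expansion ∕ dressed tower off the record exists — dag-n20-e LOCATED (F1)–(F4)); inhabitation of any regime class is K0‴ `Record13Inhabited`
(stmt-QuantumFields-19909, open, HOLD №136∕138 — nothing here reads `Provisos₁₃.bg`) and is neither used nor claimed; (V) and (I) are two-run statements NOT PRINTED ([B12]–[B16] treat one
run; [B16] p. 356 defers the observables) and NOT produced here; nothing of Bałaban's is asserted or instantiated; NE7 ∕ NE7b ∕ NE7c NOT PRINTED for d = 4 and NOT PROVED; NO node is
discharged; K3‴ NOT claimed; counts UNMOVED (typed 28∕28 · discharged 5∕27, A 5∕28); one finite four-torus programme at fixed `ε = L^{−K}` — NOT ℝ⁴, NOT infinite volume, NOT OS, NOT a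
mass gap, NOT Clay.  0 `def`, 0 `sorry`; no decl below carries a cite tag ([bookkeeping] ∕ [folklore]).
-/

open Finset

namespace Summit.QuantumFields.YangMills.BalabanUVNodes.N19TargetAtHomes13On

open Literature.MathematicalPhysics.QuantumFieldTheory.Balaban1983to89
open Literature.MathematicalPhysics.QuantumFieldTheory.Balaban1983to89.T4Continuum
open T4WeightBudget (RelWeightBound)
open T4IndicatorShell (ShellWeightBound)
open T4MatchingAssembly (HybridNE7)
open T4CauchySum (MatchingModConstants)
open T4ContinuumYM4Torus (ForSmallCouplings)
open T4ApexVariance (MatchingUnder)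
open Summit.QuantumFields.BalabanUV.T4Continuum.Spine
open Summit.QuantumFields.YangMills.BalabanUVNodes.N19AtSpineCarriers (deltaOfRecord summable_deltaOfRecord core_deltaOfRecord)
open Summit.QuantumFields.YangMills.BalabanUVNodes.N19TargetKeyed (s_U4_keyed_iff_lt_one_of_pin s_N19_keyed_iff_coreEdge_of_pin hybridNE7_keyed_of_pin
  matching_keyed_of_coreEdge)
open Summit.QuantumFields.YangMills.BalabanUVNodes.N19TargetAtRecord13 (avgMeasurable_datumOfRecord₁₃ hybridNE7Under_datumOfRecord₁₃_iff_matchingUnder)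
open Summit.QuantumFields.YangMills.BalabanUVNodes.N19SourceSplit (core_of_vacuum_of_insertion core_of_vacuum_of_insertionDeriv)
open Summit.QuantumFields.YangMills.Theorems.BalabanUVNodesN27SpineRecord (sRec₁₃On_iff_bundled coreEdge_of_homes₁₃On s_N27x_recOn₁₃_of_keyed
  forall_guarded₁₃_of_homes₁₃On forall_guarded₁₃_of_homes₁₃On_faces)
open YMDAG.UVSplit
open Node00 (Stage13Params datumOfRecord₁₃ IsRecordOfRecord₁₃C)

variable {N : ℕ} [NeZero N] (cr : SpineReading₁₃ N) (𝔯 : RateReading₁₃ N) (Rg : (F : T4Family) → Stage13Params F N → Prop) (Inputs : InputsPred N)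

/-! ## §1 N19's faces at the regime-restricted spine home `SRec₁₃On cr Rg` -/

section Faces

/-- **THE K5 STUB `S_N19` AT THE REGIME SPINE HOME** [bookkeeping]: `S_N19 (SRec₁₃On cr Rg) Inputs` ⟺ «for every family, every admissible Stage-13 θ with provisos IN THE REGIME,
every `g₀`, `os`: K4's conclusion `Inputs` read at the datum `datumOfRecord₁₃ F N θ hP` gives `Spine.NE7.Core` on the shell-free cores of `cr F θ hP g₀ os` at the reading's OWN `δ`»
((T-SPINE)'s `s_N19_sRec₁₃_iff` restricted to the regime; the guard sits INSIDE). [folklore] -/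
theorem s_N19_sRec₁₃On_iff :
    S_N19 (SRec₁₃On cr Rg) Inputs ↔ ∀ (F : T4Family) (θ : Stage13Params F N) (hP : θ.Provisos₁₃ F N), Rg F θ → θ.Admissible F N →
      ∀ (g₀ : ℕ → ℝ) (os : List (ULoop F)), Inputs F (datumOfRecord₁₃ F N θ hP) g₀ os → letI := (cr F θ hP g₀ os).dec
        NE7.Core (cr F θ hP g₀ os).l₀ (cr F θ hP g₀ os).vol (cr F θ hP g₀ os).T (cr F θ hP g₀ os).Bad
          (fun K t τ => (cr F θ hP g₀ os).A K t τ - (cr F θ hP g₀ os).shA K t τ)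
          (fun K t τ => (cr F θ hP g₀ os).B K t τ - (cr F θ hP g₀ os).shB K t τ) (cr F θ hP g₀ os).δ := by
  constructor
  · intro h F θ hP hRg hθ g₀ os hI
    exact h F (datumOfRecord₁₃ F N θ hP) g₀ os _ (sRec₁₃On_self cr Rg θ hP hRg hθ g₀ os) hI
  · rintro h F D g₀ os S ⟨θ, hP, hRg, hθ, rfl, rfl⟩ hI
    exact h F θ hP hRg hθ g₀ os hI

/-- **THE K5 STUB `S_N21` AT THE REGIME SPINE HOME** [bookkeeping] (the shell face node U5's `HybridNE7.shell` reads; (T-SPINE) §4 typed N20's `s_N20_sRec₁₃On_iff`): NE7c's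
`ShellWeightBound` at `cr F θ hP g₀ os` for every admissible θ with provisos IN THE REGIME. [folklore] -/
theorem s_N21_sRec₁₃On_iff :
    S_N21 (SRec₁₃On cr Rg) ↔ ∀ (F : T4Family) (θ : Stage13Params F N) (hP : θ.Provisos₁₃ F N), Rg F θ → θ.Admissible F N →
      ∀ (g₀ : ℕ → ℝ) (os : List (ULoop F)),
        ShellWeightBound (cr F θ hP g₀ os).l₀ (cr F θ hP g₀ os).T (cr F θ hP g₀ os).A (cr F θ hP g₀ os).B (cr F θ hP g₀ os).shA
          (cr F θ hP g₀ os).shB (cr F θ hP g₀ os).Wsh := by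
  constructor
  · intro h F θ hP hRg hθ g₀ os
    exact h F (datumOfRecord₁₃ F N θ hP) g₀ os _ (sRec₁₃On_self cr Rg θ hP hRg hθ g₀ os)
  · rintro h F D g₀ os S ⟨θ, hP, hRg, hθ, -, rfl⟩
    exact h F θ hP hRg hθ g₀ os

variable
  (hpin : ∀ (F : T4Family) (θ : Stage13Params F N) (hP : θ.Provisos₁₃ F N), Rg F θ → θ.Admissible F N → ∀ (g₀ : ℕ → ℝ) (os : List (ULoop F)),
    letI := (cr F θ hP g₀ os).dec
    (cr F θ hP g₀ os).δ = deltaOfRecord (cr F θ hP g₀ os).l₀ (cr F θ hP g₀ os).vol (cr F θ hP g₀ os).T (cr F θ hP g₀ os).Bad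
      (fun K t τ => (cr F θ hP g₀ os).A K t τ - (cr F θ hP g₀ os).shA K t τ) (fun K t τ => (cr F θ hP g₀ os).B K t τ - (cr F θ hP g₀ os).shB K t τ))
include hpin

/-- **U4′ AT THE REGIME SPINE HOME UNDER THE PIN IS ITS BUDGET HALF ALONE** [bookkeeping] (module 6b `s_U4_keyed_iff_lt_one_of_pin` at XXXIX's bundled key `sRec₁₃On_iff_bundled`; the
pin is asked only on the regime): the δ-half `Summable (cr …).δ` is `summable_deltaOfRecord` — TRUE BY CONSTRUCTION, DISPLAYED, never progress. [folklore] -/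
theorem s_U4_sRec₁₃On_iff_lt_one_of_pin :
    S_U4 (SRec₁₃On cr Rg) ↔ ∀ (F : T4Family) (θ : Stage13Params F N) (hP : θ.Provisos₁₃ F N), Rg F θ → θ.Admissible F N →
      ∀ (g₀ : ℕ → ℝ) (os : List (ULoop F)) (K : ℕ), (cr F θ hP g₀ os).W K + (cr F θ hP g₀ os).Wsh K < 1 :=
  (s_U4_keyed_iff_lt_one_of_pin (Θ := fun F => Stage13Params F N) (fun θ => θ.Provisos₁₃ _ N) (fun θ => Rg _ θ ∧ θ.Admissible _ N)
      (fun θ h => datumOfRecord₁₃ _ N θ h) (SRec₁₃On cr Rg) (fun θ h => cr _ θ h) (fun _ D g₀ os S => sRec₁₃On_iff_bundled cr Rg D g₀ os S)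
      fun F θ hP hA => hpin F θ hP hA.1 hA.2).trans
    ⟨fun h F θ hP hRg hθ => h F θ hP ⟨hRg, hθ⟩, fun h F θ hP hA => h F θ hP hA.1 hA.2⟩

/-- **THE K5 STUB `S_N19` AT THE REGIME SPINE HOME UNDER THE PIN IS THE GUARDED θ-KEYED ∃δ-EDGE** [bookkeeping] (module 6b `s_N19_keyed_iff_coreEdge_of_pin` at the bundled key):
`S_N19 (SRec₁₃On cr Rg) Inputs` ⟺ «for every admissible θ with provisos IN THE REGIME, every `g₀`, `os`: `Inputs` at `datumOfRecord₁₃ F N θ hP` gives SOME summable `δ` with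
`Spine.NE7.Core` on the shell-free cores of `cr F θ hP g₀ os`».  THE WHOLE N19 CONTENT AT THE REGIME HOME IS THAT EDGE. [folklore] -/
theorem s_N19_sRec₁₃On_iff_coreEdge_of_pin :
    S_N19 (SRec₁₃On cr Rg) Inputs ↔ ∀ (F : T4Family) (θ : Stage13Params F N) (hP : θ.Provisos₁₃ F N), Rg F θ → θ.Admissible F N →
      ∀ (g₀ : ℕ → ℝ) (os : List (ULoop F)), Inputs F (datumOfRecord₁₃ F N θ hP) g₀ os → letI := (cr F θ hP g₀ os).dec
      ∃ δ : ℕ → ℝ, NE7.Core (cr F θ hP g₀ os).l₀ (cr F θ hP g₀ os).vol (cr F θ hP g₀ os).T (cr F θ hP g₀ os).Bad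
        (fun K t τ => (cr F θ hP g₀ os).A K t τ - (cr F θ hP g₀ os).shA K t τ) (fun K t τ => (cr F θ hP g₀ os).B K t τ - (cr F θ hP g₀ os).shB K t τ) δ ∧
        Summable δ :=
  (s_N19_keyed_iff_coreEdge_of_pin (Θ := fun F => Stage13Params F N) (fun θ => θ.Provisos₁₃ _ N) (fun θ => Rg _ θ ∧ θ.Admissible _ N)
      (fun θ h => datumOfRecord₁₃ _ N θ h) (SRec₁₃On cr Rg) Inputs (fun θ h => cr _ θ h) (fun _ D g₀ os S => sRec₁₃On_iff_bundled cr Rg D g₀ os S)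
      fun F θ hP hA => hpin F θ hP hA.1 hA.2).trans
    ⟨fun h F θ hP hRg hθ => h F θ hP ⟨hRg, hθ⟩, fun h F θ hP hA => h F θ hP hA.1 hA.2⟩

/-- **`HybridNE7` FIELD BY FIELD AT THE REGIME SPINE HOME, UNDER THE PIN** [bookkeeping] — the director's R134 row at `SRec₁₃On cr Rg` (module 6b `hybridNE7_keyed_of_pin` at the bundled
key): at every bundle the regime home pins carrying K4's conclusion, node U5's hybrid datum `T4MatchingAssembly.HybridNE7` (:146) is assembled as `weight := S_N20 (SRec₁₃On cr Rg)` ·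
`shell := S_N21 (SRec₁₃On cr Rg)` · `lt_one :=` the guarded keyed budget half · `summable := summable_deltaOfRecord` (CONTENT-FREE, DISPLAYED) · `core := S_N19 (SRec₁₃On cr Rg) Inputs`;
node U5's exit `HybridNE7.matchingModConstants` (:183) then reads positivity and E1∕E2 (§3). [folklore] -/
theorem hybridNE7_at_sRec₁₃On_of_pin (h20 : S_N20 (SRec₁₃On cr Rg)) (h21 : S_N21 (SRec₁₃On cr Rg))
    (hlt : ∀ (F : T4Family) (θ : Stage13Params F N) (hP : θ.Provisos₁₃ F N), Rg F θ → θ.Admissible F N → ∀ (g₀ : ℕ → ℝ) (os : List (ULoop F)) (K : ℕ),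
      (cr F θ hP g₀ os).W K + (cr F θ hP g₀ os).Wsh K < 1)
    (h19 : S_N19 (SRec₁₃On cr Rg) Inputs) {F : T4Family} {D : Datum F N} {g₀ : ℕ → ℝ} {os : List (ULoop F)} {S : SpineCarriers}
    (hS : SRec₁₃On cr Rg F D g₀ os S) (hI : Inputs F D g₀ os) : letI := S.dec
    HybridNE7 S.l₀ S.vol S.T S.A S.B S.Bad S.W S.shA S.shB S.Wsh S.δ :=
  hybridNE7_keyed_of_pin (Θ := fun F => Stage13Params F N) (fun θ => θ.Provisos₁₃ _ N) (fun θ => Rg _ θ ∧ θ.Admissible _ N)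
    (fun θ h => datumOfRecord₁₃ _ N θ h) (SRec₁₃On cr Rg) Inputs (fun θ h => cr _ θ h) (fun _ D g₀ os S => sRec₁₃On_iff_bundled cr Rg D g₀ os S)
    (fun F θ hP hA => hpin F θ hP hA.1 hA.2) h20 h21 (fun F θ hP hA => hlt F θ hP hA.1 hA.2) h19 hS hI

/-- **XXXIX's EDGE GIVES N19's K5 STUB AT THE TWO REGIME HOMES WITH K4's ∀-HOOK, UNDER THE PIN** [bookkeeping]: the same-tuple, all-run-lengths, guarded N19′ edge `h19` implies
`S_N19 (SRec₁₃On cr Rg) (RateInputsAll (RRec₁₃On 𝔯 Rg))` (XXXIX `coreEdge_of_homes₁₃On` — the ∀-hook at the datum hands the rates at every run length of `𝔯` read AT THE SAME θ —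
then the junction `core_deltaOfRecord`).  Not an iff: the ∀-hook at a datum quantifies over every regime tuple realising it. [folklore] -/
theorem s_N19_sRec₁₃On_inputsAll_of_towerEdge
    (h19 : ∀ (F : T4Family) (θ : Stage13Params F N) (hP : θ.Provisos₁₃ F N), Rg F θ → θ.Admissible F N → ∀ (g₀ : ℕ → ℝ) (os : List (ULoop F)),
      (∀ k : ℕ, RatesAt (datumOfRecord₁₃ F N θ hP) (rateCarriersOfRecord₁₃ 𝔯 F θ hP g₀ os k)) → letI := (cr F θ hP g₀ os).dec
        ∃ δ : ℕ → ℝ, NE7.Core (cr F θ hP g₀ os).l₀ (cr F θ hP g₀ os).vol (cr F θ hP g₀ os).T (cr F θ hP g₀ os).Bad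
          (fun K t τ => (cr F θ hP g₀ os).A K t τ - (cr F θ hP g₀ os).shA K t τ) (fun K t τ => (cr F θ hP g₀ os).B K t τ - (cr F θ hP g₀ os).shB K t τ) δ ∧
          Summable δ) :
    S_N19 (SRec₁₃On cr Rg) (RateInputsAll (RRec₁₃On 𝔯 Rg)) := by
  intro F D g₀ os S hS hin
  have hc := coreEdge_of_homes₁₃On cr 𝔯 Rg h19 F D g₀ os S hS hin
  obtain ⟨θ, hP, hRg, hθ, -, rfl⟩ := hS
  letI := (cr F θ hP g₀ os).dec
  have hcore := core_deltaOfRecord hc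
  rw [← hpin F θ hP hRg hθ g₀ os] at hcore
  exact hcore

end Faces

/-! ## §3 Node U5's DECL target at every admissible Stage-13 tuple IN THE REGIME -/

section Target

/-- **THE LITERAL :183 ROAD AT THE REGIME SPINE HOME, GUARDED BY K4's CONCLUSION** [bookkeeping] (module 6b `matching_keyed_of_coreEdge` at XXXIX's bundled key and regime-keyed
datum class `fun F D _ => ∃ θ h, (Rg F θ ∧ θ.Admissible F N) ∧ D = datumOfRecord₁₃ F N θ h`; `hAvgD` = B1 at the datum): `S_N27x` at that class (e.g. XXXIX `s_N27x_recOn₁₃_of_keyed`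
from the guarded keyed extraction clause) · `S_N20` · `S_N21` at `SRec₁₃On cr Rg` · the guarded keyed budget half · the guarded keyed ∃δ-edge with `Inputs` read at the datum ⇒ at
every admissible θ with provisos IN THE REGIME, under (B) and END at its datum, for all small-coupling tuned runs and every loop string carrying `Inputs`:
`∃ l₀ vol δ′, 0 < l₀ ∧ Summable δ′ ∧ MatchingModConstants vol l₀ δ′ (schemeZ ((datumOfRecord₁₃ F N θ hP).scheme g₀) os)` — the NODE-TABLE DECL target of N19 (`MatchingModConstants … ∧
Summable δ`, :99) through `HybridNE7.matchingModConstants` (:183), per string, at the guarded Stage-13 datum. [folklore] -/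
theorem matching_guarded_datumOfRecord₁₃_of_coreEdge
    (hx : S_N27x (fun F D _ => ∃ (θ : Stage13Params F N) (h : θ.Provisos₁₃ F N), (Rg F θ ∧ θ.Admissible F N) ∧ D = datumOfRecord₁₃ F N θ h) (SRec₁₃On cr Rg))
    (h20 : S_N20 (SRec₁₃On cr Rg)) (h21 : S_N21 (SRec₁₃On cr Rg))
    (hlt : ∀ (F : T4Family) (θ : Stage13Params F N) (hP : θ.Provisos₁₃ F N), Rg F θ → θ.Admissible F N → ∀ (g₀ : ℕ → ℝ) (os : List (ULoop F)) (K : ℕ),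
      (cr F θ hP g₀ os).W K + (cr F θ hP g₀ os).Wsh K < 1)
    (hedge : ∀ (F : T4Family) (θ : Stage13Params F N) (hP : θ.Provisos₁₃ F N), Rg F θ → θ.Admissible F N → ∀ (g₀ : ℕ → ℝ) (os : List (ULoop F)),
      Inputs F (datumOfRecord₁₃ F N θ hP) g₀ os → letI := (cr F θ hP g₀ os).dec
      ∃ δ : ℕ → ℝ, NE7.Core (cr F θ hP g₀ os).l₀ (cr F θ hP g₀ os).vol (cr F θ hP g₀ os).T (cr F θ hP g₀ os).Bad
        (fun K t τ => (cr F θ hP g₀ os).A K t τ - (cr F θ hP g₀ os).shA K t τ) (fun K t τ => (cr F θ hP g₀ os).B K t τ - (cr F θ hP g₀ os).shB K t τ) δ ∧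
        Summable δ)
    (F : T4Family) (θ : Stage13Params F N) (hP : θ.Provisos₁₃ F N) (hRg : Rg F θ) (hθ : θ.Admissible F N)
    (hB : B16.EndStatementBPrinted (datumOfRecord₁₃ F N θ hP).C) (hE : DagBinding.EndpointExistence (datumOfRecord₁₃ F N θ hP).C.toB12) :
    ForSmallCouplings (datumOfRecord₁₃ F N θ hP) fun g₀ => ∀ os : List (ULoop F), Inputs F (datumOfRecord₁₃ F N θ hP) g₀ os →
      ∃ (l₀ vol : ℝ) (δ' : ℕ → ℝ), 0 < l₀ ∧ Summable δ' ∧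
        MatchingModConstants vol l₀ δ' (T4GenFunBounds.schemeZ ((datumOfRecord₁₃ F N θ hP).scheme g₀) os) := by
  obtain ⟨w₀⟩ := Node00.nonempty_worldP
  exact matching_keyed_of_coreEdge (Θ := fun F => Stage13Params F N) (fun θ => θ.Provisos₁₃ _ N) (fun θ => Rg _ θ ∧ θ.Admissible _ N)
    (fun θ h => datumOfRecord₁₃ _ N θ h)
    (fun F D _ => ∃ (θ : Stage13Params F N) (h : θ.Provisos₁₃ F N), (Rg F θ ∧ θ.Admissible F N) ∧ D = datumOfRecord₁₃ F N θ h) (SRec₁₃On cr Rg) Inputs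
    (fun θ h => cr _ θ h) (fun _ D g₀ os S => sRec₁₃On_iff_bundled cr Rg D g₀ os S) (fun _ _ _ hR => hR) (fun _ θ hP _ => avgMeasurable_datumOfRecord₁₃ θ hP)
    hx h20 h21 (fun F θ hP hA => hlt F θ hP hA.1 hA.2) (fun F θ hP hA => hedge F θ hP hA.1 hA.2) (w := w₀) ⟨θ, hP, ⟨hRg, hθ⟩, rfl⟩ hB hE

/-- **NODE U5's DECL TARGET ON THE REGIME FROM THE STUB INSTANCES OF THE TWO REGIME HOMES AND XXXIX's EDGE** [bookkeeping]: the six K4 stubs at `RRec₁₃On 𝔯 Rg` (n22-e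
`s_N1x_rRec₁₃On_iff`: each node's estimate asked only of admissible tuples IN THE REGIME, read at θ), `S_N20` ∕ `S_N21` at `SRec₁₃On cr Rg`, the guarded keyed extraction clause and
the same-tuple all-run-lengths guarded edge ⇒ «for every admissible Stage-13 θ with provisos IN THE REGIME, `MatchingUnder (datumOfRecord₁₃ F N θ hP) END`» (XXXIX
`forall_guarded₁₃_of_homes₁₃On` ∘ module 23 `hybridNE7Under_datumOfRecord₁₃_iff_matchingUnder` — B5 = U5 at the datum by B1).  THE GUARD REACHES EVERY HYPOTHESIS. [folklore] -/
theorem matchingUnder_guarded_datumOfRecord₁₃_of_homes₁₃On (h14 : S_N14 (RRec₁₃On 𝔯 Rg)) (h15 : S_N15 (RRec₁₃On 𝔯 Rg)) (h16 : S_N16 (RRec₁₃On 𝔯 Rg))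
    (h17 : S_N17 (RRec₁₃On 𝔯 Rg)) (h18 : S_N18 (RRec₁₃On 𝔯 Rg)) (h22 : S_N22 (RRec₁₃On 𝔯 Rg)) (h20 : S_N20 (SRec₁₃On cr Rg)) (h21 : S_N21 (SRec₁₃On cr Rg))
    (hx : ∀ (F : T4Family) (θ : Stage13Params F N) (hP : θ.Provisos₁₃ F N), Rg F θ → θ.Admissible F N →
      B16.EndStatementBPrinted (datumOfRecord₁₃ F N θ hP).C → DagBinding.EndpointExistence (datumOfRecord₁₃ F N θ hP).C.toB12 →
        ForSmallCouplings (datumOfRecord₁₃ F N θ hP) fun g₀ => ∀ os : List (ULoop F),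
          0 < (cr F θ hP g₀ os).l₀ ∧ 0 < (cr F θ hP g₀ os).vol ∧
          (∀ (K : ℕ) (t : ℝ), |t| ≤ (cr F θ hP g₀ os).l₀ →
            T4GenFunBounds.schemeZ ((datumOfRecord₁₃ F N θ hP).scheme g₀) os ((cr F θ hP g₀ os).K₀ + K) t =
              ∑ τ ∈ (cr F θ hP g₀ os).T K, (cr F θ hP g₀ os).A K t τ) ∧
          (∀ (K : ℕ) (t : ℝ), |t| ≤ (cr F θ hP g₀ os).l₀ →
            T4GenFunBounds.schemeZ ((datumOfRecord₁₃ F N θ hP).scheme g₀) os ((cr F θ hP g₀ os).K₀ + K + 1) t =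
              ∑ τ ∈ (cr F θ hP g₀ os).T K, (cr F θ hP g₀ os).B K t τ))
    (h19 : ∀ (F : T4Family) (θ : Stage13Params F N) (hP : θ.Provisos₁₃ F N), Rg F θ → θ.Admissible F N → ∀ (g₀ : ℕ → ℝ) (os : List (ULoop F)),
      (∀ k : ℕ, RatesAt (datumOfRecord₁₃ F N θ hP) (rateCarriersOfRecord₁₃ 𝔯 F θ hP g₀ os k)) → letI := (cr F θ hP g₀ os).dec
        ∃ δ : ℕ → ℝ, NE7.Core (cr F θ hP g₀ os).l₀ (cr F θ hP g₀ os).vol (cr F θ hP g₀ os).T (cr F θ hP g₀ os).Bad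
          (fun K t τ => (cr F θ hP g₀ os).A K t τ - (cr F θ hP g₀ os).shA K t τ) (fun K t τ => (cr F θ hP g₀ os).B K t τ - (cr F θ hP g₀ os).shB K t τ) δ ∧
          Summable δ)
    (F : T4Family) (θ : Stage13Params F N) (hP : θ.Provisos₁₃ F N) (hRg : Rg F θ) (hθ : θ.Admissible F N) :
    MatchingUnder (datumOfRecord₁₃ F N θ hP) (DagBinding.EndpointExistence (datumOfRecord₁₃ F N θ hP).C.toB12) :=
  (hybridNE7Under_datumOfRecord₁₃_iff_matchingUnder θ hP _).mp (forall_guarded₁₃_of_homes₁₃On cr 𝔯 Rg h14 h15 h16 h17 h18 h22 h20 h21 hx h19 F θ hP hRg hθ)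

/-- **THE SAME WITH EVERY STUB IN ITS GUARDED θ-FORM** [bookkeeping] (XXXIX `forall_guarded₁₃_of_homes₁₃On_faces` ∘ module 23's iff): the six rates jointly at every run length of the
rate reading, N20 `RelWeightBound` ∕ N21 `ShellWeightBound` at the spine reading, the extraction clause and the edge — all asked ONLY of admissible tuples with provisos in the regime ⇒
node U5's target at every such tuple's datum. [folklore] -/
theorem matchingUnder_guarded_datumOfRecord₁₃_of_homes₁₃On_faces
    (hrates : ∀ (F : T4Family) (θ : Stage13Params F N) (hP : θ.Provisos₁₃ F N), Rg F θ → θ.Admissible F N → ∀ (g₀ : ℕ → ℝ) (os : List (ULoop F)) (k : ℕ),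
      RatesAt (datumOfRecord₁₃ F N θ hP) (rateCarriersOfRecord₁₃ 𝔯 F θ hP g₀ os k))
    (h20 : ∀ (F : T4Family) (θ : Stage13Params F N) (hP : θ.Provisos₁₃ F N), Rg F θ → θ.Admissible F N → ∀ (g₀ : ℕ → ℝ) (os : List (ULoop F)),
      RelWeightBound (cr F θ hP g₀ os).l₀ (cr F θ hP g₀ os).T (cr F θ hP g₀ os).A (cr F θ hP g₀ os).B (cr F θ hP g₀ os).Bad (cr F θ hP g₀ os).W)
    (h21 : ∀ (F : T4Family) (θ : Stage13Params F N) (hP : θ.Provisos₁₃ F N), Rg F θ → θ.Admissible F N → ∀ (g₀ : ℕ → ℝ) (os : List (ULoop F)),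
      ShellWeightBound (cr F θ hP g₀ os).l₀ (cr F θ hP g₀ os).T (cr F θ hP g₀ os).A (cr F θ hP g₀ os).B (cr F θ hP g₀ os).shA (cr F θ hP g₀ os).shB
        (cr F θ hP g₀ os).Wsh)
    (hx : ∀ (F : T4Family) (θ : Stage13Params F N) (hP : θ.Provisos₁₃ F N), Rg F θ → θ.Admissible F N →
      B16.EndStatementBPrinted (datumOfRecord₁₃ F N θ hP).C → DagBinding.EndpointExistence (datumOfRecord₁₃ F N θ hP).C.toB12 →
        ForSmallCouplings (datumOfRecord₁₃ F N θ hP) fun g₀ => ∀ os : List (ULoop F),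
          0 < (cr F θ hP g₀ os).l₀ ∧ 0 < (cr F θ hP g₀ os).vol ∧
          (∀ (K : ℕ) (t : ℝ), |t| ≤ (cr F θ hP g₀ os).l₀ →
            T4GenFunBounds.schemeZ ((datumOfRecord₁₃ F N θ hP).scheme g₀) os ((cr F θ hP g₀ os).K₀ + K) t =
              ∑ τ ∈ (cr F θ hP g₀ os).T K, (cr F θ hP g₀ os).A K t τ) ∧
          (∀ (K : ℕ) (t : ℝ), |t| ≤ (cr F θ hP g₀ os).l₀ →
            T4GenFunBounds.schemeZ ((datumOfRecord₁₃ F N θ hP).scheme g₀) os ((cr F θ hP g₀ os).K₀ + K + 1) t =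
              ∑ τ ∈ (cr F θ hP g₀ os).T K, (cr F θ hP g₀ os).B K t τ))
    (h19 : ∀ (F : T4Family) (θ : Stage13Params F N) (hP : θ.Provisos₁₃ F N), Rg F θ → θ.Admissible F N → ∀ (g₀ : ℕ → ℝ) (os : List (ULoop F)),
      (∀ k : ℕ, RatesAt (datumOfRecord₁₃ F N θ hP) (rateCarriersOfRecord₁₃ 𝔯 F θ hP g₀ os k)) → letI := (cr F θ hP g₀ os).dec
        ∃ δ : ℕ → ℝ, NE7.Core (cr F θ hP g₀ os).l₀ (cr F θ hP g₀ os).vol (cr F θ hP g₀ os).T (cr F θ hP g₀ os).Bad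
          (fun K t τ => (cr F θ hP g₀ os).A K t τ - (cr F θ hP g₀ os).shA K t τ) (fun K t τ => (cr F θ hP g₀ os).B K t τ - (cr F θ hP g₀ os).shB K t τ) δ ∧
          Summable δ)
    (F : T4Family) (θ : Stage13Params F N) (hP : θ.Provisos₁₃ F N) (hRg : Rg F θ) (hθ : θ.Admissible F N) :
    MatchingUnder (datumOfRecord₁₃ F N θ hP) (DagBinding.EndpointExistence (datumOfRecord₁₃ F N θ hP).C.toB12) :=
  (hybridNE7Under_datumOfRecord₁₃_iff_matchingUnder θ hP _).mp
    (forall_guarded₁₃_of_homes₁₃On_faces cr 𝔯 Rg hrates h20 h21 hx h19 F θ hP hRg hθ)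

end Target

/-! ## §4 The SOURCE-SPLIT producer interface of the N19′ edge at the Stage-13 tuples (dag-n19-e's (V)∕(I) currency) -/

section SourceSplit

/-- **A SOURCE-SPLIT READING OF THE SPINE CARRIERS ON THE REGIME PRODUCES XXXIX's EDGE** [bookkeeping] (`N19SourceSplit.core_of_vacuum_of_insertion` BY NAME at every tuple): if at every
admissible Stage-13 θ with provisos IN THE REGIME, every `g₀`, `os` — GIVEN the six rates at every run length of `𝔯` read at θ — the reading `S := cr F θ hP g₀ os` has POSITIVE shell-free
cores on its good classes and carries (V) a class-uniform VACUUM matching and (I) a per-class SOURCE-RESPONSE matching of `log (B − shB) − log (A − shA)` with SUMMABLE remainders `δ⁰`,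
`δ¹`, then the same-tuple all-run-lengths guarded N19′ edge holds with `δ := δ⁰ + δ¹`.  (V) and (I) are the located FIRST MISSING ESTIMATE of N19 (two-run statements, NOT PRINTED);
nothing is produced here. [folklore] -/
theorem towerEdge₁₃On_of_sourceSplitReading
    (hread : ∀ (F : T4Family) (θ : Stage13Params F N) (hP : θ.Provisos₁₃ F N), Rg F θ → θ.Admissible F N → ∀ (g₀ : ℕ → ℝ) (os : List (ULoop F)),
      (∀ k : ℕ, RatesAt (datumOfRecord₁₃ F N θ hP) (rateCarriersOfRecord₁₃ 𝔯 F θ hP g₀ os k)) → letI := (cr F θ hP g₀ os).dec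
      (∀ K t, |t| ≤ (cr F θ hP g₀ os).l₀ → ∀ τ ∈ (cr F θ hP g₀ os).T K \ (cr F θ hP g₀ os).Bad K t,
        0 < (cr F θ hP g₀ os).A K t τ - (cr F θ hP g₀ os).shA K t τ ∧ 0 < (cr F θ hP g₀ os).B K t τ - (cr F θ hP g₀ os).shB K t τ) ∧
      ∃ δ₀ δ₁ : ℕ → ℝ, Summable δ₀ ∧ Summable δ₁ ∧
        (∀ K, ∃ c : ℝ, ∀ t : ℝ, |t| ≤ (cr F θ hP g₀ os).l₀ → ∀ τ ∈ (cr F θ hP g₀ os).T K \ (cr F θ hP g₀ os).Bad K t,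
          |Real.log ((cr F θ hP g₀ os).B K 0 τ - (cr F θ hP g₀ os).shB K 0 τ) - Real.log ((cr F θ hP g₀ os).A K 0 τ - (cr F θ hP g₀ os).shA K 0 τ) - c| ≤
            (cr F θ hP g₀ os).vol * δ₀ K) ∧
        (∀ K (t : ℝ), |t| ≤ (cr F θ hP g₀ os).l₀ → ∀ τ ∈ (cr F θ hP g₀ os).T K \ (cr F θ hP g₀ os).Bad K t,
          |(Real.log ((cr F θ hP g₀ os).B K t τ - (cr F θ hP g₀ os).shB K t τ) - Real.log ((cr F θ hP g₀ os).A K t τ - (cr F θ hP g₀ os).shA K t τ)) -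
              (Real.log ((cr F θ hP g₀ os).B K 0 τ - (cr F θ hP g₀ os).shB K 0 τ) - Real.log ((cr F θ hP g₀ os).A K 0 τ - (cr F θ hP g₀ os).shA K 0 τ))| ≤
            (cr F θ hP g₀ os).vol * δ₁ K))
    (F : T4Family) (θ : Stage13Params F N) (hP : θ.Provisos₁₃ F N) (hRg : Rg F θ) (hθ : θ.Admissible F N) (g₀ : ℕ → ℝ) (os : List (ULoop F))
    (hall : ∀ k : ℕ, RatesAt (datumOfRecord₁₃ F N θ hP) (rateCarriersOfRecord₁₃ 𝔯 F θ hP g₀ os k)) : letI := (cr F θ hP g₀ os).dec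
    ∃ δ : ℕ → ℝ, NE7.Core (cr F θ hP g₀ os).l₀ (cr F θ hP g₀ os).vol (cr F θ hP g₀ os).T (cr F θ hP g₀ os).Bad
      (fun K t τ => (cr F θ hP g₀ os).A K t τ - (cr F θ hP g₀ os).shA K t τ) (fun K t τ => (cr F θ hP g₀ os).B K t τ - (cr F θ hP g₀ os).shB K t τ) δ ∧
      Summable δ := by
  letI := (cr F θ hP g₀ os).dec
  obtain ⟨hpos, δ₀, δ₁, h0, h1, hV, hI⟩ := hread F θ hP hRg hθ g₀ os hall
  exact ⟨fun K => δ₀ K + δ₁ K,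
    core_of_vacuum_of_insertion (fun K t ht τ hτ => (hpos K t ht τ hτ).1) (fun K t ht τ hτ => (hpos K t ht τ hτ).2) hV hI, h0.add h1⟩

/-- **AN INSERTION-DERIVATIVE READING ON THE REGIME PRODUCES XXXIX's EDGE** [bookkeeping] (`N19SourceSplit.core_of_vacuum_of_insertionDeriv` BY NAME): at every admissible θ with provisos
IN THE REGIME, every `g₀`, `os`, given the rates at every run length: `0 < vol`, positive shell-free cores on the good classes, (V) with summable `δ⁰`, SOURCE-DIFFERENTIABLE log-cores
on `[−l₀, l₀]` with derivatives `mA`, `mB` (the two runs' tilted insertion means) and `|mB − mA| ≤ Λ_K` along the source segment of every good class, `0 ≤ Λ` SUMMABLE ⇒ the edge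
with `δ := δ⁰ + Λ·l₀∕vol`. [folklore] -/
theorem towerEdge₁₃On_of_insertionDerivReading
    (hread : ∀ (F : T4Family) (θ : Stage13Params F N) (hP : θ.Provisos₁₃ F N), Rg F θ → θ.Admissible F N → ∀ (g₀ : ℕ → ℝ) (os : List (ULoop F)),
      (∀ k : ℕ, RatesAt (datumOfRecord₁₃ F N θ hP) (rateCarriersOfRecord₁₃ 𝔯 F θ hP g₀ os k)) → letI := (cr F θ hP g₀ os).dec
      0 < (cr F θ hP g₀ os).vol ∧
      (∀ K t, |t| ≤ (cr F θ hP g₀ os).l₀ → ∀ τ ∈ (cr F θ hP g₀ os).T K \ (cr F θ hP g₀ os).Bad K t,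
        0 < (cr F θ hP g₀ os).A K t τ - (cr F θ hP g₀ os).shA K t τ ∧ 0 < (cr F θ hP g₀ os).B K t τ - (cr F θ hP g₀ os).shB K t τ) ∧
      ∃ (δ₀ Λ : ℕ → ℝ) (mA mB : ℕ → ℝ → (cr F θ hP g₀ os).ι → ℝ), Summable δ₀ ∧ Summable Λ ∧ (∀ K, 0 ≤ Λ K) ∧
        (∀ K, ∃ c : ℝ, ∀ t : ℝ, |t| ≤ (cr F θ hP g₀ os).l₀ → ∀ τ ∈ (cr F θ hP g₀ os).T K \ (cr F θ hP g₀ os).Bad K t,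
          |Real.log ((cr F θ hP g₀ os).B K 0 τ - (cr F θ hP g₀ os).shB K 0 τ) - Real.log ((cr F θ hP g₀ os).A K 0 τ - (cr F θ hP g₀ os).shA K 0 τ) - c| ≤
            (cr F θ hP g₀ os).vol * δ₀ K) ∧
        (∀ K, ∀ τ ∈ (cr F θ hP g₀ os).T K, ∀ s ∈ Set.Icc (-(cr F θ hP g₀ os).l₀) (cr F θ hP g₀ os).l₀,
          HasDerivWithinAt (fun s => Real.log ((cr F θ hP g₀ os).A K s τ - (cr F θ hP g₀ os).shA K s τ)) (mA K s τ)
            (Set.Icc (-(cr F θ hP g₀ os).l₀) (cr F θ hP g₀ os).l₀) s) ∧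
        (∀ K, ∀ τ ∈ (cr F θ hP g₀ os).T K, ∀ s ∈ Set.Icc (-(cr F θ hP g₀ os).l₀) (cr F θ hP g₀ os).l₀,
          HasDerivWithinAt (fun s => Real.log ((cr F θ hP g₀ os).B K s τ - (cr F θ hP g₀ os).shB K s τ)) (mB K s τ)
            (Set.Icc (-(cr F θ hP g₀ os).l₀) (cr F θ hP g₀ os).l₀) s) ∧
        (∀ K (t : ℝ), |t| ≤ (cr F θ hP g₀ os).l₀ → ∀ τ ∈ (cr F θ hP g₀ os).T K \ (cr F θ hP g₀ os).Bad K t, ∀ s ∈ Set.uIcc (0 : ℝ) t,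
          |mB K s τ - mA K s τ| ≤ Λ K))
    (F : T4Family) (θ : Stage13Params F N) (hP : θ.Provisos₁₃ F N) (hRg : Rg F θ) (hθ : θ.Admissible F N) (g₀ : ℕ → ℝ) (os : List (ULoop F))
    (hall : ∀ k : ℕ, RatesAt (datumOfRecord₁₃ F N θ hP) (rateCarriersOfRecord₁₃ 𝔯 F θ hP g₀ os k)) : letI := (cr F θ hP g₀ os).dec
    ∃ δ : ℕ → ℝ, NE7.Core (cr F θ hP g₀ os).l₀ (cr F θ hP g₀ os).vol (cr F θ hP g₀ os).T (cr F θ hP g₀ os).Bad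
      (fun K t τ => (cr F θ hP g₀ os).A K t τ - (cr F θ hP g₀ os).shA K t τ) (fun K t τ => (cr F θ hP g₀ os).B K t τ - (cr F θ hP g₀ os).shB K t τ) δ ∧
      Summable δ := by
  letI := (cr F θ hP g₀ os).dec
  obtain ⟨hvol, hpos, δ₀, Λ, mA, mB, h0, hΛs, hΛ, hV, hdA, hdB, hm⟩ := hread F θ hP hRg hθ g₀ os hall
  exact ⟨fun K => δ₀ K + Λ K * (cr F θ hP g₀ os).l₀ / (cr F θ hP g₀ os).vol,
    core_of_vacuum_of_insertionDeriv hvol hΛ (fun K t ht τ hτ => (hpos K t ht τ hτ).1) (fun K t ht τ hτ => (hpos K t ht τ hτ).2) hV hdA hdB hm,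
    h0.add ((hΛs.mul_right _).div_const _)⟩

/-- **NODE U5's DECL TARGET ON THE REGIME FROM THE STUBS AT THE TWO REGIME HOMES AND A SOURCE-SPLIT READING** [bookkeeping] (§3 `matchingUnder_guarded_datumOfRecord₁₃_of_homes₁₃On` with
the edge PRODUCED by §4 `towerEdge₁₃On_of_sourceSplitReading`): the six K4 stubs at `RRec₁₃On 𝔯 Rg`, `S_N20` ∕ `S_N21` at `SRec₁₃On cr Rg`, the guarded keyed extraction clause, and a
(V)+(I) reading of `cr` at the regime tuples ⇒ `MatchingUnder (datumOfRecord₁₃ F N θ hP) END` at every admissible θ with provisos IN THE REGIME.  What an NE7 prover must exhibit at the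
Stage-13 objects, in the source-split currency; every input a HYPOTHESIS today. [folklore] -/
theorem matchingUnder_guarded_datumOfRecord₁₃_of_homes₁₃On_sourceSplit (h14 : S_N14 (RRec₁₃On 𝔯 Rg)) (h15 : S_N15 (RRec₁₃On 𝔯 Rg))
    (h16 : S_N16 (RRec₁₃On 𝔯 Rg)) (h17 : S_N17 (RRec₁₃On 𝔯 Rg)) (h18 : S_N18 (RRec₁₃On 𝔯 Rg)) (h22 : S_N22 (RRec₁₃On 𝔯 Rg)) (h20 : S_N20 (SRec₁₃On cr Rg))
    (h21 : S_N21 (SRec₁₃On cr Rg))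
    (hx : ∀ (F : T4Family) (θ : Stage13Params F N) (hP : θ.Provisos₁₃ F N), Rg F θ → θ.Admissible F N →
      B16.EndStatementBPrinted (datumOfRecord₁₃ F N θ hP).C → DagBinding.EndpointExistence (datumOfRecord₁₃ F N θ hP).C.toB12 →
        ForSmallCouplings (datumOfRecord₁₃ F N θ hP) fun g₀ => ∀ os : List (ULoop F),
          0 < (cr F θ hP g₀ os).l₀ ∧ 0 < (cr F θ hP g₀ os).vol ∧
          (∀ (K : ℕ) (t : ℝ), |t| ≤ (cr F θ hP g₀ os).l₀ →
            T4GenFunBounds.schemeZ ((datumOfRecord₁₃ F N θ hP).scheme g₀) os ((cr F θ hP g₀ os).K₀ + K) t =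
              ∑ τ ∈ (cr F θ hP g₀ os).T K, (cr F θ hP g₀ os).A K t τ) ∧
          (∀ (K : ℕ) (t : ℝ), |t| ≤ (cr F θ hP g₀ os).l₀ →
            T4GenFunBounds.schemeZ ((datumOfRecord₁₃ F N θ hP).scheme g₀) os ((cr F θ hP g₀ os).K₀ + K + 1) t =
              ∑ τ ∈ (cr F θ hP g₀ os).T K, (cr F θ hP g₀ os).B K t τ))
    (hread : ∀ (F : T4Family) (θ : Stage13Params F N) (hP : θ.Provisos₁₃ F N), Rg F θ → θ.Admissible F N → ∀ (g₀ : ℕ → ℝ) (os : List (ULoop F)),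
      (∀ k : ℕ, RatesAt (datumOfRecord₁₃ F N θ hP) (rateCarriersOfRecord₁₃ 𝔯 F θ hP g₀ os k)) → letI := (cr F θ hP g₀ os).dec
      (∀ K t, |t| ≤ (cr F θ hP g₀ os).l₀ → ∀ τ ∈ (cr F θ hP g₀ os).T K \ (cr F θ hP g₀ os).Bad K t,
        0 < (cr F θ hP g₀ os).A K t τ - (cr F θ hP g₀ os).shA K t τ ∧ 0 < (cr F θ hP g₀ os).B K t τ - (cr F θ hP g₀ os).shB K t τ) ∧
      ∃ δ₀ δ₁ : ℕ → ℝ, Summable δ₀ ∧ Summable δ₁ ∧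
        (∀ K, ∃ c : ℝ, ∀ t : ℝ, |t| ≤ (cr F θ hP g₀ os).l₀ → ∀ τ ∈ (cr F θ hP g₀ os).T K \ (cr F θ hP g₀ os).Bad K t,
          |Real.log ((cr F θ hP g₀ os).B K 0 τ - (cr F θ hP g₀ os).shB K 0 τ) - Real.log ((cr F θ hP g₀ os).A K 0 τ - (cr F θ hP g₀ os).shA K 0 τ) - c| ≤
            (cr F θ hP g₀ os).vol * δ₀ K) ∧
        (∀ K (t : ℝ), |t| ≤ (cr F θ hP g₀ os).l₀ → ∀ τ ∈ (cr F θ hP g₀ os).T K \ (cr F θ hP g₀ os).Bad K t,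
          |(Real.log ((cr F θ hP g₀ os).B K t τ - (cr F θ hP g₀ os).shB K t τ) - Real.log ((cr F θ hP g₀ os).A K t τ - (cr F θ hP g₀ os).shA K t τ)) -
              (Real.log ((cr F θ hP g₀ os).B K 0 τ - (cr F θ hP g₀ os).shB K 0 τ) - Real.log ((cr F θ hP g₀ os).A K 0 τ - (cr F θ hP g₀ os).shA K 0 τ))| ≤
            (cr F θ hP g₀ os).vol * δ₁ K))
    (F : T4Family) (θ : Stage13Params F N) (hP : θ.Provisos₁₃ F N) (hRg : Rg F θ) (hθ : θ.Admissible F N) :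
    MatchingUnder (datumOfRecord₁₃ F N θ hP) (DagBinding.EndpointExistence (datumOfRecord₁₃ F N θ hP).C.toB12) :=
  matchingUnder_guarded_datumOfRecord₁₃_of_homes₁₃On cr 𝔯 Rg h14 h15 h16 h17 h18 h22 h20 h21 hx (towerEdge₁₃On_of_sourceSplitReading cr 𝔯 Rg hread)
    F θ hP hRg hθ

end SourceSplit

/-! ## §5 At the GUARD OF RECORD `Node00.unityNondeg₁₃ N` (rev 16's K3‴ binder prefix `θ.ZtUnity F N ∧ θ.SlotsNondegenerate₁₃ F N`; RR-2 `Record13DatumKey` §7) -/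

section UnityNondeg

/-- **NODE U5's DECL TARGET AT EVERY ADMISSIBLE STAGE-13 TUPLE WITH PRINT's PARTITION OF UNITY AND NON-DEGENERATE PRESENT SLOTS, FROM THE STUBS AT THE GUARD-RESTRICTED HOMES AND THE
SAME-TUPLE EDGE** [bookkeeping] (§3 `matchingUnder_guarded_datumOfRecord₁₃_of_homes₁₃On` at `Rg := Node00.unityNondeg₁₃ N`): the six K4 stubs at `RRec₁₃On 𝔯 (unityNondeg₁₃ N)` ((T-SPINE)₁₃'s
`SRec₁₃U cr` is `SRec₁₃On cr (unityNondeg₁₃ N)` by `rfl`), `S_N20` ∕ `S_N21` at `SRec₁₃On cr (unityNondeg₁₃ N)`, the guarded keyed extraction clause and the edge ⇒ «for every admissible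
Stage-13 θ with provisos, `θ.ZtUnity F N ∧ θ.SlotsNondegenerate₁₃ F N → MatchingUnder (datumOfRecord₁₃ F N θ hP) END`» — at `N = 2` the body of K3‴ up to its two displayed antecedents
(n27-c XXXVI `spine_rec13CN_iff_forall_guarded` ∕ XXXVII `spineGivenEndpointR13_iff_spine_rec13CN`, B5 = U5 at the datum by module 23); with the edge PRODUCED by a source-split
reading it is §4 `matchingUnder_guarded_datumOfRecord₁₃_of_homes₁₃On_sourceSplit cr 𝔯 (Node00.unityNondeg₁₃ N)` (same one-liner). [folklore] -/
theorem matchingUnder_unityNondeg_datumOfRecord₁₃_of_homes₁₃On (h14 : S_N14 (RRec₁₃On 𝔯 (Node00.unityNondeg₁₃ N)))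
    (h15 : S_N15 (RRec₁₃On 𝔯 (Node00.unityNondeg₁₃ N))) (h16 : S_N16 (RRec₁₃On 𝔯 (Node00.unityNondeg₁₃ N))) (h17 : S_N17 (RRec₁₃On 𝔯 (Node00.unityNondeg₁₃ N)))
    (h18 : S_N18 (RRec₁₃On 𝔯 (Node00.unityNondeg₁₃ N))) (h22 : S_N22 (RRec₁₃On 𝔯 (Node00.unityNondeg₁₃ N))) (h20 : S_N20 (SRec₁₃On cr (Node00.unityNondeg₁₃ N)))
    (h21 : S_N21 (SRec₁₃On cr (Node00.unityNondeg₁₃ N)))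
    (hx : ∀ (F : T4Family) (θ : Stage13Params F N) (hP : θ.Provisos₁₃ F N), (θ.ZtUnity F N ∧ θ.SlotsNondegenerate₁₃ F N) → θ.Admissible F N →
      B16.EndStatementBPrinted (datumOfRecord₁₃ F N θ hP).C → DagBinding.EndpointExistence (datumOfRecord₁₃ F N θ hP).C.toB12 →
        ForSmallCouplings (datumOfRecord₁₃ F N θ hP) fun g₀ => ∀ os : List (ULoop F),
          0 < (cr F θ hP g₀ os).l₀ ∧ 0 < (cr F θ hP g₀ os).vol ∧
          (∀ (K : ℕ) (t : ℝ), |t| ≤ (cr F θ hP g₀ os).l₀ →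
            T4GenFunBounds.schemeZ ((datumOfRecord₁₃ F N θ hP).scheme g₀) os ((cr F θ hP g₀ os).K₀ + K) t =
              ∑ τ ∈ (cr F θ hP g₀ os).T K, (cr F θ hP g₀ os).A K t τ) ∧
          (∀ (K : ℕ) (t : ℝ), |t| ≤ (cr F θ hP g₀ os).l₀ →
            T4GenFunBounds.schemeZ ((datumOfRecord₁₃ F N θ hP).scheme g₀) os ((cr F θ hP g₀ os).K₀ + K + 1) t =
              ∑ τ ∈ (cr F θ hP g₀ os).T K, (cr F θ hP g₀ os).B K t τ))
    (h19 : ∀ (F : T4Family) (θ : Stage13Params F N) (hP : θ.Provisos₁₃ F N), (θ.ZtUnity F N ∧ θ.SlotsNondegenerate₁₃ F N) → θ.Admissible F N →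
      ∀ (g₀ : ℕ → ℝ) (os : List (ULoop F)), (∀ k : ℕ, RatesAt (datumOfRecord₁₃ F N θ hP) (rateCarriersOfRecord₁₃ 𝔯 F θ hP g₀ os k)) → letI := (cr F θ hP g₀ os).dec
        ∃ δ : ℕ → ℝ, NE7.Core (cr F θ hP g₀ os).l₀ (cr F θ hP g₀ os).vol (cr F θ hP g₀ os).T (cr F θ hP g₀ os).Bad
          (fun K t τ => (cr F θ hP g₀ os).A K t τ - (cr F θ hP g₀ os).shA K t τ) (fun K t τ => (cr F θ hP g₀ os).B K t τ - (cr F θ hP g₀ os).shB K t τ) δ ∧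
          Summable δ)
    (F : T4Family) (θ : Stage13Params F N) (hP : θ.Provisos₁₃ F N) (hU : θ.ZtUnity F N ∧ θ.SlotsNondegenerate₁₃ F N) (hθ : θ.Admissible F N) :
    MatchingUnder (datumOfRecord₁₃ F N θ hP) (DagBinding.EndpointExistence (datumOfRecord₁₃ F N θ hP).C.toB12) :=
  matchingUnder_guarded_datumOfRecord₁₃_of_homes₁₃On cr 𝔯 (Node00.unityNondeg₁₃ N) h14 h15 h16 h17 h18 h22 h20 h21 hx h19 F θ hP hU hθ

end UnityNondeg

end Summit.QuantumFields.YangMills.BalabanUVNodes.N19TargetAtHomes13On
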